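import Mathlib
import Literature.NumberTheory.Sieve.Maynard2016CoupledKernelWBound
import HarnessLib

/-!
# Maynard (2016), Lemma 7: absolute convergence of the weighted coupled kernel

Topic `Literature/NumberTheory/Sieve`; trunk AntSieve / parity (Maynard 2016 large-gaps ladder, named
fact `Literature.NumberTheory.Sieve.Maynard2016.Lemma7Tuple` of `Maynard2016Lemma7PerTuple.lean`).

J. Maynard, *Large gaps between primes*, Ann. of Math. (2) 183 (2016), 915–933 = arXiv:1408.5110,
§6: proof of Lemma 6 ("the expression is absolutely convergent", "`∏_p K_p ≪ (log x)^{O_k(1)}`")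
and Lemma 7, display (6.32) (the same computation with the denominator `φ([d,e,d',e'])`).  This file
is the absolute-convergence layer of `Maynard2016CoupledKernel` (`sum_norm_coupledEulerTerm_le`,
`summable_norm_coupledEulerTerm`, `hasSum_coupledEulerTerm`, `norm_coupledKernel_le`) for the
weighted kernel `coupledKernelW w` of `Maynard2016CoupledKernelW`, for every `IsLcmWeight w`
(`w(p)` multiplicative over distinct primes, `|w(p)| ≤ 2/p`; e.g. `w = 1/φ`,
`PolymathLcmSumsEuler.isLcmWeight_totient_inv`): every finite partial sum of the `|terms|` is at most
`coupledKernelBoundW k₁ k₂ σ = exp(2(3k₁ + 3k₂ + 9k₁k₂) ∑_n n^{-1-σ})`.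

## References

* J. Maynard, *Large gaps between primes*, Ann. of Math. (2) 183 (2016), 915–933; arXiv:1408.5110,
  §6, (6.9)–(6.11) and (6.32). [Maynard2016LargeGaps]
-/

noncomputable section

open Filter Finset ArithmeticFunction
open scoped BigOperators Topology ArithmeticFunction.Moebius Classical

namespace Literature.NumberTheory.Sieve

namespace LcmEuler

variable {ι κ : Type*} [Fintype ι] [DecidableEq ι] [Fintype κ] [DecidableEq κ]

/-! ### The uniform bound -/

omit [Fintype ι] [DecidableEq ι] [Fintype κ] [DecidableEq κ] in
/-- The uniform bound `exp(2(3k₁ + 3k₂ + 9k₁k₂) ∑_n n^{-1-σ})` for the weighted absolute kernel.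
[cite: Maynard2016LargeGaps, §6 (proof of Lemma 6, after (6.11)) and Lemma 7 (6.32)] -/
def coupledKernelBoundW (k₁ k₂ : ℕ) (σ : ℝ) : ℝ :=
  Real.exp (2 * (3 * k₁ + 3 * k₂ + 9 * k₁ * k₂) * zetaBoundSum σ)

omit [Fintype ι] [DecidableEq ι] [Fintype κ] [DecidableEq κ] in
/-- The uniform bound is positive. [cite: Maynard2016LargeGaps, §6 (proof of Lemma 6, after (6.11))] -/
theorem coupledKernelBoundW_pos (k₁ k₂ : ℕ) (σ : ℝ) : 0 < coupledKernelBoundW k₁ k₂ σ :=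
  Real.exp_pos _

/-! ### Support of the weighted terms -/

omit [Fintype ι] [Fintype κ] in
/-- On pairs supported on primes of `P` not dividing `W`, `CoupledAdm` is pairwise coprimality on both
sides together with the finite cross condition `CrossCond P`. [folklore] -/
private theorem coupledAdm_iff_of_mem_pairBox'' [Fintype ι] [Fintype κ] {P : Finset ℕ}
    (hP : ∀ q ∈ P, q.Prime) {W : ℕ} (hPW : ∀ q ∈ P, ¬ q ∣ W) (m : ℕ) (M : ℕ → Finset (ι × κ))
    {tD : (ι → ℕ) × (ι → ℕ)} {tE : (κ → ℕ) × (κ → ℕ)} (htD : tD ∈ pairBox ι P)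
    (htE : tE ∈ pairBox κ P) :
    CoupledAdm W m M tD tE ↔
      PairwiseCoprimeLcm tD ∧ PairwiseCoprimeLcm tE ∧ CrossCond P m M tD tE := by
  rw [CoupledAdm, lcmCoprime_iff_of_mem_pairBox hP hPW htD, lcmCoprime_iff_of_mem_pairBox hP hPW htE,
    CrossCond]
  have hmem := htD
  simp only [pairBox, Finset.mem_product, Fintype.mem_piFinset, Nat.mem_divisors] at hmem
  constructor
  · rintro ⟨h1, h2, h3, h4⟩
    exact ⟨h1, h2, h3, fun q hq i j hdi hej => h4 q (hP q hq) i j hdi hej⟩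
  · rintro ⟨h1, h2, h3, h4⟩
    refine ⟨h1, h2, h3, fun p hp i j hdi hej => h4 p ?_ i j hdi hej⟩
    have hdvd : p ∣ ∏ q ∈ P, q := hdi.trans (Nat.lcm_dvd (hmem.1 i).1 (hmem.2 i).1)
    obtain ⟨q, hq, hpq⟩ := (hp.prime.dvd_finsetProd_iff _).1 hdvd
    rwa [(Nat.prime_dvd_prime_iff_eq hp (hP q hq)).1 hpq]

omit [DecidableEq ι] [DecidableEq κ] in
/-- A non-zero weighted coupled term is admissible with squarefree entries.
[cite: Maynard2016LargeGaps, §6 (proof of Lemma 6, (6.9))] -/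
theorem support_coupledEulerTermW {w : ℕ → ℂ} {W m : ℕ} {M : ℕ → Finset (ι × κ)} {a b : ι → ℂ}
    {a' b' : κ → ℂ} {t : ((ι → ℕ) × (ι → ℕ)) × ((κ → ℕ) × (κ → ℕ))}
    (h : coupledEulerTermW w W m M a b a' b' t ≠ 0) :
    CoupledAdm W m M t.1 t.2 ∧ (∀ i, Squarefree (t.1.1 i) ∧ Squarefree (t.1.2 i)) ∧
      ∀ j, Squarefree (t.2.1 j) ∧ Squarefree (t.2.2 j) := by
  unfold coupledEulerTermW at h
  split_ifs at h with hc
  · rw [coupledSummandW] at h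
    have hnum := (mul_ne_zero_iff.1 h).1
    have hD := (mul_ne_zero_iff.1 hnum).1
    have hE := (mul_ne_zero_iff.1 hnum).2
    refine ⟨hc, fun i => ?_, fun j => ?_⟩
    · have hi := Finset.prod_ne_zero_iff.1 hD i (Finset.mem_univ i)
      have h1 : (μ (t.1.1 i) : ℂ) ≠ 0 := by intro h0; apply hi; simp [moebiusWeight, h0]
      have h2 : (μ (t.1.2 i) : ℂ) ≠ 0 := by intro h0; apply hi; simp [moebiusWeight, h0]
      exact ⟨ArithmeticFunction.moebius_ne_zero_iff_squarefree.1 (by exact_mod_cast h1),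
        ArithmeticFunction.moebius_ne_zero_iff_squarefree.1 (by exact_mod_cast h2)⟩
    · have hj := Finset.prod_ne_zero_iff.1 hE j (Finset.mem_univ j)
      have h1 : (μ (t.2.1 j) : ℂ) ≠ 0 := by intro h0; apply hj; simp [moebiusWeight, h0]
      have h2 : (μ (t.2.2 j) : ℂ) ≠ 0 := by intro h0; apply hj; simp [moebiusWeight, h0]
      exact ⟨ArithmeticFunction.moebius_ne_zero_iff_squarefree.1 (by exact_mod_cast h1),
        ArithmeticFunction.moebius_ne_zero_iff_squarefree.1 (by exact_mod_cast h2)⟩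
  · exact absurd rfl h

omit [DecidableEq ι] [DecidableEq κ] in
/-- Non-zero weighted coupled terms are pairs of good pairs (squarefree entries coprime to `W`).
[cite: Maynard2016LargeGaps, §6 (proof of Lemma 6, (6.9))] -/
theorem goodPair_of_coupledEulerTermW_ne_zero {w : ℕ → ℂ} {W m : ℕ} {M : ℕ → Finset (ι × κ)}
    {a b : ι → ℂ} {a' b' : κ → ℂ} {t : ((ι → ℕ) × (ι → ℕ)) × ((κ → ℕ) × (κ → ℕ))}
    (h : coupledEulerTermW w W m M a b a' b' t ≠ 0) : GoodPair W t.1 ∧ GoodPair W t.2 := by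
  obtain ⟨hc, hsqD, hsqE⟩ := support_coupledEulerTermW h
  refine ⟨fun i => ⟨(hsqD i).1, (hsqD i).2, ?_, ?_⟩, fun j => ⟨(hsqE j).1, (hsqE j).2, ?_, ?_⟩⟩
  · exact (hc.1.2 i).coprime_dvd_left (Nat.dvd_lcm_left _ _)
  · exact (hc.1.2 i).coprime_dvd_left (Nat.dvd_lcm_right _ _)
  · exact (hc.2.1.2 j).coprime_dvd_left (Nat.dvd_lcm_left _ _)
  · exact (hc.2.1.2 j).coprime_dvd_left (Nat.dvd_lcm_right _ _)

/-! ### Summability and the uniform bound -/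

/-- **Absolute convergence of the weighted coupled kernel, quantitatively**: for an `IsLcmWeight w`
every finite partial sum of the `|terms|` is at most `coupledKernelBoundW k₁ k₂ σ`.
[cite: Maynard2016LargeGaps, §6 (proof of Lemma 6, (6.9)–(6.11)) and Lemma 7 (6.32)] -/
theorem sum_norm_coupledEulerTermW_le {w : ℕ → ℂ} (hw : IsLcmWeight w) {W m : ℕ}
    (M : ℕ → Finset (ι × κ)) {a b : ι → ℂ} {a' b' : κ → ℂ} {σ : ℝ} (hσ : 0 < σ)
    (hab : ∀ i, σ ≤ (a i).re ∧ σ ≤ (b i).re) (hab' : ∀ j, σ ≤ (a' j).re ∧ σ ≤ (b' j).re)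
    (u : Finset (((ι → ℕ) × (ι → ℕ)) × ((κ → ℕ) × (κ → ℕ)))) :
    ∑ t ∈ u, ‖coupledEulerTermW w W m M a b a' b' t‖ ≤
      coupledKernelBoundW (Fintype.card ι) (Fintype.card κ) σ := by
  obtain ⟨hvmult, hvle⟩ := normWeight_of_isLcmWeight hw
  -- a bound for the entries occurring in `u`
  set N : ℕ := u.sup (fun t => max (Finset.univ.sup fun i => max (t.1.1 i) (t.1.2 i))
    (Finset.univ.sup fun j => max (t.2.1 j) (t.2.2 j))) + 1 with hN
  have hNlt : ∀ t ∈ u, (∀ i, t.1.1 i < N ∧ t.1.2 i < N) ∧ ∀ j, t.2.1 j < N ∧ t.2.2 j < N := by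
    intro t ht
    have h2 : max (Finset.univ.sup fun i => max (t.1.1 i) (t.1.2 i))
        (Finset.univ.sup fun j => max (t.2.1 j) (t.2.2 j)) ≤
        u.sup (fun t => max (Finset.univ.sup fun i => max (t.1.1 i) (t.1.2 i))
          (Finset.univ.sup fun j => max (t.2.1 j) (t.2.2 j))) :=
      Finset.le_sup (f := fun t => max (Finset.univ.sup fun i => max (t.1.1 i) (t.1.2 i))
        (Finset.univ.sup fun j => max (t.2.1 j) (t.2.2 j))) ht
    constructor
    · intro i
      have h1 : max (t.1.1 i) (t.1.2 i) ≤ Finset.univ.sup fun i => max (t.1.1 i) (t.1.2 i) :=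
        Finset.le_sup (f := fun i => max (t.1.1 i) (t.1.2 i)) (Finset.mem_univ i)
      constructor <;> omega
    · intro j
      have h1 : max (t.2.1 j) (t.2.2 j) ≤ Finset.univ.sup fun j => max (t.2.1 j) (t.2.2 j) :=
        Finset.le_sup (f := fun j => max (t.2.1 j) (t.2.2 j)) (Finset.mem_univ j)
      constructor <;> omega
  set P := primesBelowNotDvd W N with hPdef
  have hP : ∀ q ∈ P, q.Prime := fun q hq => prime_of_mem_primesBelowNotDvd hq
  have hPW : ∀ q ∈ P, ¬ q ∣ W := fun q hq => not_dvd_of_mem_primesBelowNotDvd hq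
  -- Step 1: restrict to the non-zero terms, which lie in `pairBox P × pairBox P`
  have hstep1 : ∑ t ∈ u, ‖coupledEulerTermW w W m M a b a' b' t‖ ≤
      ∑ t ∈ pairBox ι P ×ˢ pairBox κ P, ‖coupledEulerTermW w W m M a b a' b' t‖ := by
    calc ∑ t ∈ u, ‖coupledEulerTermW w W m M a b a' b' t‖
        = ∑ t ∈ u.filter (fun t => coupledEulerTermW w W m M a b a' b' t ≠ 0),
            ‖coupledEulerTermW w W m M a b a' b' t‖ := by
          rw [Finset.sum_filter]
          refine Finset.sum_congr rfl fun t _ => ?_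
          split_ifs with h
          · rfl
          · rw [not_not.1 h, norm_zero]
      _ ≤ _ := by
          refine Finset.sum_le_sum_of_subset_of_nonneg (fun t ht => ?_) (fun _ _ _ => norm_nonneg _)
          obtain ⟨htu, hne⟩ := Finset.mem_filter.1 ht
          obtain ⟨hg1, hg2⟩ := goodPair_of_coupledEulerTermW_ne_zero hne
          exact Finset.mem_product.2 ⟨mem_pairBox_of_goodPair hg1 (hNlt t htu).1,
            mem_pairBox_of_goodPair hg2 (hNlt t htu).2⟩
  -- Step 2: the sum over the box, cast to `ℂ`, is the finite absolute Euler product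
  have hstep2 : ((∑ t ∈ pairBox ι P ×ˢ pairBox κ P, ‖coupledEulerTermW w W m M a b a' b' t‖ : ℝ) : ℂ) =
      ∏ q ∈ P, coupledLocalFactorW (normWeight (moebiusWeight a)) (normWeight (moebiusWeight b))
        (normWeight (moebiusWeight a')) (normWeight (moebiusWeight b'))
        (fun n => ((‖w n‖ : ℝ) : ℂ)) m M q := by
    push_cast
    rw [Finset.sum_congr rfl fun t _ => norm_coupledEulerTermW_eq w (W := W) (m := m) (M := M)
      (a := a) (b := b) (a' := a') (b' := b') t, Finset.sum_product]
    have h2 : ∀ tD ∈ pairBox ι P, ∑ tE ∈ pairBox κ P,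
        (if CoupledAdm W m M (tD, tE).1 (tD, tE).2 then
          coupledSummandW (normWeight (moebiusWeight a)) (normWeight (moebiusWeight b))
            (normWeight (moebiusWeight a')) (normWeight (moebiusWeight b'))
            (fun n => ((‖w n‖ : ℝ) : ℂ)) (tD, tE).1 (tD, tE).2
          else 0) =
        if PairwiseCoprimeLcm tD then ∑ tE ∈ (pairBox κ P).filter PairwiseCoprimeLcm,
          (if CrossCond P m M tD tE then
            coupledSummandW (normWeight (moebiusWeight a)) (normWeight (moebiusWeight b))
              (normWeight (moebiusWeight a')) (normWeight (moebiusWeight b'))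
              (fun n => ((‖w n‖ : ℝ) : ℂ)) tD tE else 0) else 0 := by
      intro tD htD
      have h3 : ∀ tE ∈ pairBox κ P,
          (if CoupledAdm W m M (tD, tE).1 (tD, tE).2 then
            coupledSummandW (normWeight (moebiusWeight a)) (normWeight (moebiusWeight b))
              (normWeight (moebiusWeight a')) (normWeight (moebiusWeight b'))
              (fun n => ((‖w n‖ : ℝ) : ℂ)) (tD, tE).1 (tD, tE).2
            else 0) =
          if PairwiseCoprimeLcm tD then
            (if PairwiseCoprimeLcm tE then
              (if CrossCond P m M tD tE then
                coupledSummandW (normWeight (moebiusWeight a)) (normWeight (moebiusWeight b))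
                  (normWeight (moebiusWeight a')) (normWeight (moebiusWeight b'))
                  (fun n => ((‖w n‖ : ℝ) : ℂ)) tD tE else 0)
              else 0) else 0 := by
        intro tE htE
        simp only
        rw [if_congr (coupledAdm_iff_of_mem_pairBox'' hP hPW m M htD htE) rfl rfl]
        by_cases hD : PairwiseCoprimeLcm tD <;> by_cases hE : PairwiseCoprimeLcm tE <;>
          by_cases hC : CrossCond P m M tD tE <;> simp [hD, hE, hC]
      rw [Finset.sum_congr rfl h3]
      split_ifs with hD
      · rw [Finset.sum_filter]
      · simp
    rw [Finset.sum_congr rfl h2, ← Finset.sum_filter]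
    exact sum_coupledW_eq_prod hP _ _ _ _
      (fun i => ((isPrimeProdMult_moebius_cpow (a i)).norm : IsPrimeProdMult (normWeight (moebiusWeight a) i)))
      (fun i => ((isPrimeProdMult_moebius_cpow (b i)).norm : IsPrimeProdMult (normWeight (moebiusWeight b) i)))
      (fun j => ((isPrimeProdMult_moebius_cpow (a' j)).norm : IsPrimeProdMult (normWeight (moebiusWeight a') j)))
      (fun j => ((isPrimeProdMult_moebius_cpow (b' j)).norm : IsPrimeProdMult (normWeight (moebiusWeight b') j)))
      hvmult m M
  -- Step 3: norms
  have hnonneg : 0 ≤ ∑ t ∈ pairBox ι P ×ˢ pairBox κ P, ‖coupledEulerTermW w W m M a b a' b' t‖ :=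
    Finset.sum_nonneg fun _ _ => norm_nonneg _
  have hstep3 : ∑ t ∈ pairBox ι P ×ˢ pairBox κ P, ‖coupledEulerTermW w W m M a b a' b' t‖ ≤
      ∏ q ∈ P, Real.exp (2 * (3 * Fintype.card ι + 3 * Fintype.card κ +
        9 * Fintype.card ι * Fintype.card κ) * (q : ℝ) ^ (-(1 + σ))) := by
    have e : ∑ t ∈ pairBox ι P ×ˢ pairBox κ P, ‖coupledEulerTermW w W m M a b a' b' t‖ =
        ‖((∑ t ∈ pairBox ι P ×ˢ pairBox κ P, ‖coupledEulerTermW w W m M a b a' b' t‖ : ℝ) : ℂ)‖ := by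
      rw [Complex.norm_real, Real.norm_eq_abs, abs_of_nonneg hnonneg]
    rw [e, hstep2]
    refine (Finset.norm_prod_le _ _).trans (Finset.prod_le_prod (fun _ _ => norm_nonneg _) fun q hq => ?_)
    exact norm_coupledLocalFactorW_normWeight_le hσ.le hab hab' _ m M (hP q hq).one_lt.le
      (hvle q (hP q hq))
  refine hstep1.trans (hstep3.trans ?_)
  rw [← Real.exp_sum, ← Finset.mul_sum, coupledKernelBoundW]
  refine Real.exp_le_exp.2 (mul_le_mul_of_nonneg_left ?_ (by positivity))
  exact (summable_rpow_neg_one_add hσ).sum_le_tsum P fun n _ => Real.rpow_nonneg (Nat.cast_nonneg n) _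

/-- The weighted coupled terms are absolutely summable.
[cite: Maynard2016LargeGaps, §6 (proof of Lemma 6, after (6.9)) and Lemma 7 (6.32)] -/
theorem summable_norm_coupledEulerTermW {w : ℕ → ℂ} (hw : IsLcmWeight w) {W m : ℕ}
    (M : ℕ → Finset (ι × κ)) {a b : ι → ℂ} {a' b' : κ → ℂ} {σ : ℝ} (hσ : 0 < σ)
    (hab : ∀ i, σ ≤ (a i).re ∧ σ ≤ (b i).re) (hab' : ∀ j, σ ≤ (a' j).re ∧ σ ≤ (b' j).re) :
    Summable fun t => ‖coupledEulerTermW w W m M a b a' b' t‖ :=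
  summable_of_sum_le (fun _ => norm_nonneg _) (sum_norm_coupledEulerTermW_le hw M hσ hab hab')

/-- The weighted coupled kernel is the sum of its terms (absolute convergence of (6.32)).
[cite: Maynard2016LargeGaps, §6 display (6.10) and Lemma 7 (6.32)] -/
theorem hasSum_coupledEulerTermW {w : ℕ → ℂ} (hw : IsLcmWeight w) {W m : ℕ}
    (M : ℕ → Finset (ι × κ)) {a b : ι → ℂ} {a' b' : κ → ℂ} {σ : ℝ} (hσ : 0 < σ)
    (hab : ∀ i, σ ≤ (a i).re ∧ σ ≤ (b i).re) (hab' : ∀ j, σ ≤ (a' j).re ∧ σ ≤ (b' j).re) :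
    HasSum (coupledEulerTermW w W m M a b a' b') (coupledKernelW w W m M a b a' b') :=
  (summable_norm_coupledEulerTermW hw M hσ hab hab').of_norm.hasSum

/-- `‖∑_{t ∈ u} termsW‖ ≤ coupledKernelBoundW` for every finite `u`.
[cite: Maynard2016LargeGaps, §6 (proof of Lemma 6, after (6.11)) and Lemma 7 (6.32)] -/
theorem norm_sum_coupledEulerTermW_le {w : ℕ → ℂ} (hw : IsLcmWeight w) {W m : ℕ}
    (M : ℕ → Finset (ι × κ)) {a b : ι → ℂ} {a' b' : κ → ℂ} {σ : ℝ} (hσ : 0 < σ)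
    (hab : ∀ i, σ ≤ (a i).re ∧ σ ≤ (b i).re) (hab' : ∀ j, σ ≤ (a' j).re ∧ σ ≤ (b' j).re)
    (u : Finset (((ι → ℕ) × (ι → ℕ)) × ((κ → ℕ) × (κ → ℕ)))) :
    ‖∑ t ∈ u, coupledEulerTermW w W m M a b a' b' t‖ ≤
      coupledKernelBoundW (Fintype.card ι) (Fintype.card κ) σ :=
  (norm_sum_le _ _).trans (sum_norm_coupledEulerTermW_le hw M hσ hab hab' u)

/-- **`∏_p K^w_p ≪ (log x)^{O_k(1)}`** in the form `‖K^w‖ ≤ coupledKernelBoundW k₁ k₂ σ`.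
[cite: Maynard2016LargeGaps, §6 (proof of Lemma 6, after (6.11)) and Lemma 7 (6.32)] -/
theorem norm_coupledKernelW_le {w : ℕ → ℂ} (hw : IsLcmWeight w) {W m : ℕ}
    (M : ℕ → Finset (ι × κ)) {a b : ι → ℂ} {a' b' : κ → ℂ} {σ : ℝ} (hσ : 0 < σ)
    (hab : ∀ i, σ ≤ (a i).re ∧ σ ≤ (b i).re) (hab' : ∀ j, σ ≤ (a' j).re ∧ σ ≤ (b' j).re) :
    ‖coupledKernelW w W m M a b a' b'‖ ≤ coupledKernelBoundW (Fintype.card ι) (Fintype.card κ) σ := by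
  rw [coupledKernelW]
  refine (norm_tsum_le_tsum_norm (summable_norm_coupledEulerTermW hw M hσ hab hab')).trans ?_
  exact (summable_norm_coupledEulerTermW hw M hσ hab hab').tsum_le_of_sum_le
    (sum_norm_coupledEulerTermW_le hw M hσ hab hab')

end LcmEuler

end Literature.NumberTheory.Sieve

end
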